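import Mathlib
import Literature.NumberTheory.Sieve.BombieriVinogradovReduction
import Literature.NumberTheory.LFunctions.PagePNTWithExceptionalZeroProofs

/-!
# The descent (stub `stub_descent` of line `upward-replication-free-factorability`, crux `EH`)

The bookkeeping transfer of the line: the four number-theoretic inputs, taken VERBATIM as
hypotheses — `H1` (low conductors are harmless: `∑_{q ≤ x^θ} E♭_D(x; q) = O(x/(log x)^A)`,
`E♭_D(x; q) = max_a ‖Δ(x; q, a) − Δ♯_D(x; q, a)‖`, `D = ⌊x^{1/2−δ₀}⌋`), `H2` (replication:
`E♯_D(x; q) ≤ (p − 1) E♯_D(x; qp) + R(qp, x)` for a prime `p ∤ q`, with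
`E♯_D(x; q) = max_a ‖Δ♯_D(x; q, a)‖`, `Δ♯_D(x; q, a) = φ(q)⁻¹ ∑_{cond χ > D} χ(a⁻¹) ψ(x, χ)`,
`R(m, x) = ∑_{n ≤ x, (n, m) > 1} Λ(n)` = `Literature.NumberTheory.Sieve.nonCoprimePart`), `H3`
(top-window purity off an exceptional set `I`, `#I ≤ x^{1−ε'−η}`) and `H4` (bad moduli are
harmonically sparse: `∑_{q bad} 1/φ(q) ≤ K x^{−η} (log x)²`) — imply the Wave0 form
`Literature.NumberTheory.Sieve.ElliottHalberstamConjecture = ∀ θ < 1, EH θ` of the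
Elliott–Halberstam conjecture.  No character theory and no prime counting happens in this file.

Proof.  Fix `θ < 1`; it suffices to treat `A > 0` (`x/(log x)^{max(A,1)} ≤ x/(log x)^A` once
`log x ≥ 1`).  Put `ε' = min(1/2, (1−θ)/2)`, `B = A + 2`; `H3` gives `δ₀, η, x₀` and, for
`x ≥ x₀`, the set `I`; `H4` (with `κ = 1 − ε' − θ > 0`) gives `K, x₁`; `H1` gives `C₀`.  At
height `x`, for `q ≤ x^θ` and a unit `a`, `|Δ(x; q, a)| ≤ E♭(q) + E♯(q)` (triangle inequality
under the maximum, `ciSup_abs_le_ciSup_add`).  A modulus `q` is GOOD if some prime `p ∤ q` in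
`(x^{1−ε'}/q, 2x^{1−ε'}/q]` has `qp ∉ I`: then `qp` lies in the top window, and purity with
replication give `E♯(q) ≤ (p−1)·x/(φ(qp)(log x)^B) + R(qp, x) = x/(φ(q)(log x)^B) + R(qp, x)`
(`φ(qp) = φ(q)(p−1)`, `le_of_replication_of_pure`), where `R(qp, x) ≤ 3 (log x)²`
(`nonCoprimePart_le`).  For the other (BAD) moduli the trivial bound
`0 ≤ ψ(x; q, a) ≤ (x/q + 1) log x`
(`Literature.NumberTheory.LFunctions.PagePNT.chebyshevPsiMod_le_trivial`) gives
`max_a |Δ| ≤ (x log x + x)/φ(q) + log x`, and the defining property of BAD is exactly the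
hypothesis of `H4`.  Summing (`sum_le_of_good_bad`) and using `∑_{q ≤ Q} 1/φ(q) ≤ (1 + log Q)²`
(`Literature.NumberTheory.Sieve.totientInvSum_le`), with `L = log x`:
`∑_q max_a |Δ| ≤ C₀ x/L^A + 4x L²/L^{A+2} + 3 x^θ L² + (xL + x) K x^{−η} L² + x^θ L`, and each
term is `≪ x/L^A` since `L^{A+2} ≤ x^{1−θ}` and `L^{A+3} ≤ x^η` eventually (`numeric_bound`,
`eventually_rpow_mul_log_pow_le`).

References: H. Davenport, *Multiplicative Number Theory*, 2nd ed., Springer GTM 74 (1980),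
ch. 28 (the Bombieri–Vinogradov bookkeeping); H. L. Montgomery, R. C. Vaughan,
*Multiplicative Number Theory I*, CUP 2007, proof of Corollary 11.17 (the trivial bound).
-/

open Finset Real Filter Asymptotics

namespace Summit.Parity.GeneralizedHardyLittlewood.Theorems.EH.Descent

open Literature.NumberTheory.Sieve Literature.NumberTheory.LFunctions

/-! ### Pointwise inequalities at one modulus -/

/-- Triangle inequality under a finite maximum: `max_i |f i| ≤ max_i ‖f i − v i‖ + max_i ‖v i‖`,
with `|r| = ‖(r : ℂ)‖`. [folklore] -/
theorem ciSup_abs_le_ciSup_add {ι : Type*} [Finite ι] [Nonempty ι] (f : ι → ℝ) (v : ι → ℂ) :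
    ⨆ i, |f i| ≤ (⨆ i, ‖((f i : ℝ) : ℂ) - v i‖) + ⨆ i, ‖v i‖ := by
  refine ciSup_le fun i => ?_
  calc |f i| = ‖((f i : ℝ) : ℂ)‖ := by rw [Complex.norm_real, Real.norm_eq_abs]
    _ ≤ ‖((f i : ℝ) : ℂ) - v i‖ + ‖v i‖ := by
        rw [add_comm]; exact norm_le_norm_add_norm_sub' _ _
    _ ≤ _ := add_le_add (le_ciSup (Finite.bddAbove_range fun i => ‖((f i : ℝ) : ℂ) - v i‖) i)
          (le_ciSup (Finite.bddAbove_range fun i => ‖v i‖) i)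

/-- The trivial bound for the discrepancy: for `q ≥ 1`, `x ≥ 1`,
`max_a |ψ(x; q, a) − x/φ(q)| ≤ (x log x + x)/φ(q) + log x`, from `0 ≤ ψ(x; q, a) ≤ (x/q + 1) log x`
(`chebyshevPsiMod_le_trivial`) and `φ(q) ≤ q`.
[cite: MontgomeryVaughan2007, Corollary 11.17 (proof)] -/
theorem ciSup_abs_sub_le_trivial {q : ℕ} (hq : 1 ≤ q) {x : ℝ} (hx : 1 ≤ x) :
    ⨆ a : (ZMod q)ˣ, |ParityWave0.chebyshevPsiMod q (a : ZMod q) x - x / (Nat.totient q : ℝ)| ≤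
      (x * Real.log x + x) / (Nat.totient q : ℝ) + Real.log x := by
  haveI : NeZero q := ⟨by omega⟩
  have hL : 0 ≤ Real.log x := Real.log_nonneg hx
  have hx0 : 0 ≤ x := zero_le_one.trans hx
  have hφ : 0 < (Nat.totient q : ℝ) := by exact_mod_cast Nat.totient_pos.2 hq
  have hφq : (Nat.totient q : ℝ) ≤ q := by exact_mod_cast Nat.totient_le q
  have hxq : x / q ≤ x / Nat.totient q := div_le_div_of_nonneg_left hx0 hφ hφq
  refine ciSup_le fun a => ?_
  have hψ0 : 0 ≤ ParityWave0.chebyshevPsiMod q (a : ZMod q) x :=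
    Finset.sum_nonneg fun n _ => ArithmeticFunction.vonMangoldt.residueClass_nonneg (a : ZMod q) n
  have hψ := PagePNT.chebyshevPsiMod_le_trivial hq (a : ZMod q) hx
  have h1 : x / Nat.totient q ≤ (x * Real.log x + x) / Nat.totient q :=
    div_le_div_of_nonneg_right (le_add_of_nonneg_left (mul_nonneg hx0 hL)) hφ.le
  refine abs_le.2 ⟨by linarith [div_nonneg hx0 hφ.le], ?_⟩
  calc ParityWave0.chebyshevPsiMod q (a : ZMod q) x - x / Nat.totient q
      ≤ (x / q + 1) * Real.log x := by linarith [div_nonneg hx0 hφ.le]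
    _ ≤ (x / Nat.totient q + 1) * Real.log x := by gcongr
    _ = x * Real.log x / Nat.totient q + Real.log x := by ring
    _ ≤ (x * Real.log x + x) / Nat.totient q + Real.log x := by
        gcongr; exact le_add_of_nonneg_right hx0

/-- Replication and purity at one good modulus: if `E♯(q) ≤ (p − 1) E♯(qp) + R` and
`E♯(qp) < x/(φ(qp) M)` for a prime `p ∤ q`, then `E♯(q) ≤ x/(φ(q) M) + R`, because
`φ(qp) = φ(q)(p − 1)` (`Nat.totient_mul`, `Nat.totient_prime`). [folklore] -/
theorem le_of_replication_of_pure {q p : ℕ} (hq : 1 ≤ q) (hp : p.Prime) (hpq : ¬ p ∣ q)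
    {e₁ e₂ R x M : ℝ} (hM : 0 < M) (h₁ : e₁ ≤ ((p : ℝ) - 1) * e₂ + R)
    (h₂ : e₂ < x / ((Nat.totient (q * p) : ℝ) * M)) :
    e₁ ≤ x / ((Nat.totient q : ℝ) * M) + R := by
  have hcop : Nat.Coprime q p := ((Nat.Prime.coprime_iff_not_dvd hp).2 hpq).symm
  have hp2 : (2 : ℝ) ≤ p := by exact_mod_cast hp.two_le
  have hp1 : (0 : ℝ) < (p : ℝ) - 1 := by linarith
  have hφ : (Nat.totient (q * p) : ℝ) = Nat.totient q * ((p : ℝ) - 1) := by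
    rw [Nat.totient_mul hcop, Nat.totient_prime hp, Nat.cast_mul, Nat.cast_sub hp.one_le,
      Nat.cast_one]
  have hφq : (0 : ℝ) < Nat.totient q := by exact_mod_cast Nat.totient_pos.2 hq
  have key : ((p : ℝ) - 1) * e₂ ≤ x / ((Nat.totient q : ℝ) * M) :=
    calc ((p : ℝ) - 1) * e₂ ≤ ((p : ℝ) - 1) * (x / ((Nat.totient (q * p) : ℝ) * M)) :=
          mul_le_mul_of_nonneg_left h₂.le hp1.le
      _ = x / ((Nat.totient q : ℝ) * M) := by
          rw [hφ]; field_simp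
  linarith

/-- The remainder `R(m, x) = ∑_{n ≤ x, (n, m) > 1} Λ(n)` is at most `3 (log x)²` for `1 ≤ m ≤ 2x`,
`x ≥ 2`: `R ≤ ⌊log x/log 2⌋ log m` (`nonCoprimePart_le`), `log(2x) ≤ 2 log x` and `2/log 2 < 3`.
[folklore] -/
theorem nonCoprimePart_le_three_mul_log_sq {m : ℕ} (hm : m ≠ 0) {x : ℝ} (hx : 2 ≤ x)
    (hmx : (m : ℝ) ≤ 2 * x) : nonCoprimePart m x ≤ 3 * Real.log x ^ 2 := by
  have hx0 : 0 < x := by linarith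
  have hL2 : Real.log 2 ≤ Real.log x := Real.log_le_log two_pos hx
  have hlog2 : (0.6931471803 : ℝ) < Real.log 2 := Real.log_two_gt_d9
  have hl2pos : 0 < Real.log 2 := by linarith
  have hL0 : 0 ≤ Real.log x := hl2pos.le.trans hL2
  have hm0 : (0 : ℝ) < m := by exact_mod_cast Nat.pos_of_ne_zero hm
  have hlogm : Real.log m ≤ 2 * Real.log x := by
    calc Real.log m ≤ Real.log (2 * x) := Real.log_le_log hm0 hmx
      _ = Real.log 2 + Real.log x := Real.log_mul two_ne_zero hx0.ne'
      _ ≤ 2 * Real.log x := by linarith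
  calc nonCoprimePart m x ≤ ⌊Real.log x / Real.log 2⌋₊ * Real.log m := nonCoprimePart_le hm hx0.le
    _ ≤ (Real.log x / Real.log 2) * (2 * Real.log x) :=
        mul_le_mul (Nat.floor_le (div_nonneg hL0 hl2pos.le)) hlogm (Real.log_natCast_nonneg m)
          (div_nonneg hL0 hl2pos.le)
    _ = (2 / Real.log 2) * Real.log x ^ 2 := by ring
    _ ≤ 3 * Real.log x ^ 2 := by
        gcongr
        rw [div_le_iff₀ hl2pos]; linarith

/-! ### The descent at one height -/

/-- The good/bad bookkeeping at one height `x`, abstractly: `T(q) = max_a |Δ(x; q, a)|`,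
`Eb = E♭`, `Es = E♯`, `R(m) = R(m, x)`, window `(w, 2w]`, level `Q`, purity tolerance `M`.  If
`T ≤ Eb + Es`, `T ≤ (xL + x)/φ + L`, replication holds with remainder `R ≤ r` on `(w, 2w]`, purity
holds off `I` on the window and the harmonic sum over every BAD set is `≤ K'`, then
`∑_{q ≤ Q} T(q) ≤ ∑_{q ≤ Q} Eb(q) + (x/M) W(Q) + Q r + (xL + x) K' + Q L`. [folklore] -/
theorem sum_le_of_good_bad {x L M r K' w : ℝ} {Q : ℕ} {I : Finset ℕ} {T Eb Es R : ℕ → ℝ}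
    (hx : 0 ≤ x) (hL : 0 ≤ L) (hM : 0 < M) (hr : 0 ≤ r)
    (hT₁ : ∀ q ∈ Finset.Icc 1 Q, T q ≤ Eb q + Es q)
    (hT₂ : ∀ q ∈ Finset.Icc 1 Q, T q ≤ (x * L + x) / (Nat.totient q : ℝ) + L)
    (hEb : ∀ q ∈ Finset.Icc 1 Q, 0 ≤ Eb q)
    (hrep : ∀ q ∈ Finset.Icc 1 Q, ∀ p : ℕ, p.Prime → ¬ p ∣ q →
      Es q ≤ ((p : ℝ) - 1) * Es (q * p) + R (q * p))
    (hR : ∀ m : ℕ, m ≠ 0 → (m : ℝ) ≤ 2 * w → R m ≤ r)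
    (hpur : ∀ m ∈ Finset.Ioc ⌊w⌋₊ ⌊2 * w⌋₊, m ∉ I → Es m < x / ((Nat.totient m : ℝ) * M))
    (hbad : ∀ Bad : Finset ℕ, Bad ⊆ Finset.Icc 1 Q →
      (∀ q ∈ Bad, ∀ p : ℕ, p.Prime → ¬ p ∣ q →
          w / q < p → (p : ℝ) ≤ 2 * w / q → q * p ∈ I) →
        ∑ q ∈ Bad, ((Nat.totient q : ℝ))⁻¹ ≤ K') :
    ∑ q ∈ Finset.Icc 1 Q, T q ≤
      ∑ q ∈ Finset.Icc 1 Q, Eb q + x / M * totientInvSum Q + Q * r + (x * L + x) * K' + Q * L := by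
  classical
  set S := Finset.Icc 1 Q with hS
  have hcardS : S.card = Q := by rw [hS, Nat.card_Icc, add_tsub_cancel_right]
  -- good moduli
  have hgood : ∀ q ∈ S, (∃ p : ℕ, p.Prime ∧ ¬ p ∣ q ∧ w / q < p ∧ (p : ℝ) ≤ 2 * w / q ∧
      q * p ∉ I) → T q ≤ Eb q + x / ((Nat.totient q : ℝ) * M) + r := by
    rintro q hq ⟨p, hp, hpq, hlow, hup, hI⟩
    have hq1 : 1 ≤ q := (Finset.mem_Icc.1 hq).1
    have hq0 : (0 : ℝ) < q := by exact_mod_cast hq1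
    have hm0 : q * p ≠ 0 := Nat.mul_ne_zero (by omega) hp.ne_zero
    have hlow' : w < ((q * p : ℕ) : ℝ) := by rw [div_lt_iff₀ hq0] at hlow; push_cast; linarith
    have hup' : ((q * p : ℕ) : ℝ) ≤ 2 * w := by rw [le_div_iff₀ hq0] at hup; push_cast; linarith
    have hmem : q * p ∈ Finset.Ioc ⌊w⌋₊ ⌊2 * w⌋₊ :=
      Finset.mem_Ioc.2 ⟨(Nat.floor_lt' hm0).2 hlow', Nat.le_floor hup'⟩
    have key := le_of_replication_of_pure hq1 hp hpq hM (hrep q hq p hp hpq) (hpur _ hmem hI)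
    linarith [hT₁ q hq, hR _ hm0 hup']
  -- split
  rw [← Finset.sum_filter_add_sum_filter_not S (fun q => ∃ p : ℕ, p.Prime ∧ ¬ p ∣ q ∧
      w / q < p ∧ (p : ℝ) ≤ 2 * w / q ∧ q * p ∉ I)]
  set Bad := S.filter (fun q => ¬ ∃ p : ℕ, p.Prime ∧ ¬ p ∣ q ∧ w / q < p ∧
      (p : ℝ) ≤ 2 * w / q ∧ q * p ∉ I) with hBad
  have hBadS : Bad ⊆ S := Finset.filter_subset _ _
  have hBadI : ∀ q ∈ Bad, ∀ p : ℕ, p.Prime → ¬ p ∣ q → w / q < p → (p : ℝ) ≤ 2 * w / q →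
      q * p ∈ I := fun q hq p hp hpq hlow hup =>
    not_not.1 fun hI => (Finset.mem_filter.1 hq).2 ⟨p, hp, hpq, hlow, hup, hI⟩
  have hK := hbad Bad hBadS hBadI
  have h1 : ∑ q ∈ S with ∃ p : ℕ, p.Prime ∧ ¬ p ∣ q ∧ w / q < p ∧ (p : ℝ) ≤ 2 * w / q ∧
      q * p ∉ I, T q ≤ ∑ q ∈ S, (Eb q + x / ((Nat.totient q : ℝ) * M) + r) := by
    refine (Finset.sum_le_sum fun q hq => hgood q (Finset.mem_of_mem_filter q hq)
      (Finset.mem_filter.1 hq).2).trans ?_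
    exact Finset.sum_le_sum_of_subset_of_nonneg (Finset.filter_subset _ _) fun q hq _ =>
      add_nonneg (add_nonneg (hEb q hq) (by positivity)) hr
  have h2 : ∑ q ∈ Bad, T q ≤ ∑ q ∈ Bad, ((x * L + x) / (Nat.totient q : ℝ) + L) :=
    Finset.sum_le_sum fun q hq => hT₂ q (hBadS hq)
  have h3 : ∑ q ∈ S, (Eb q + x / ((Nat.totient q : ℝ) * M) + r) =
      ∑ q ∈ S, Eb q + x / M * totientInvSum Q + Q * r := by
    rw [Finset.sum_add_distrib, Finset.sum_add_distrib, Finset.sum_const, hcardS, nsmul_eq_mul,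
      totientInvSum, Finset.mul_sum]
    congr 2
    refine Finset.sum_congr rfl fun q _ => ?_
    rw [mul_comm ((Nat.totient q : ℝ)), ← div_div, div_eq_mul_inv]
  have h4 : ∑ q ∈ Bad, ((x * L + x) / (Nat.totient q : ℝ) + L) ≤ (x * L + x) * K' + Q * L := by
    rw [Finset.sum_add_distrib, Finset.sum_const, nsmul_eq_mul]
    have hc : (Bad.card : ℝ) ≤ Q := by exact_mod_cast hcardS ▸ Finset.card_le_card hBadS
    simp only [div_eq_mul_inv]
    rw [← Finset.mul_sum]
    have hxL : 0 ≤ x * L + x := by positivity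
    linarith [mul_le_mul_of_nonneg_left hK hxL, mul_le_mul_of_nonneg_right hc hL]
  linarith

/-! ### The eventual comparisons with `x/(log x)^A` -/

/-- For `s > 0`, `n : ℕ`, `A : ℝ`: eventually `x^{1−s} (log x)^n ≤ x/(log x)^A`, from
`(log x)^{A+n} ≤ x^s` eventually (`eventually_log_rpow_le_rpow`). [folklore] -/
theorem eventually_rpow_mul_log_pow_le (n : ℕ) (A : ℝ) {s : ℝ} (hs : 0 < s) :
    ∀ᶠ x : ℝ in atTop, x ^ (1 - s) * Real.log x ^ n ≤ x / Real.log x ^ A := by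
  filter_upwards [eventually_log_rpow_le_rpow (A + n) hs, eventually_gt_atTop 1] with x h hx
  have hx0 : 0 < x := by linarith
  have hL : 0 < Real.log x := Real.log_pos hx
  rw [le_div_iff₀ (Real.rpow_pos_of_pos hL _)]
  calc x ^ (1 - s) * Real.log x ^ n * Real.log x ^ A = x ^ (1 - s) * Real.log x ^ (A + n) := by
        rw [Real.rpow_add hL, Real.rpow_natCast]; ring
    _ ≤ x ^ (1 - s) * x ^ s := by gcongr
    _ = x := by rw [← Real.rpow_add hx0, sub_add_cancel, Real.rpow_one]

/-- `W(Q) = ∑_{m ≤ Q} 1/φ(m) ≤ 4 (log x)²` for `Q ≤ x` and `log x ≥ 1`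
(`totientInvSum_le`). [folklore] -/
theorem totientInvSum_le_four_mul_log_sq {Q : ℕ} {x : ℝ} (hQ : (Q : ℝ) ≤ x)
    (hL : 1 ≤ Real.log x) : totientInvSum Q ≤ 4 * Real.log x ^ 2 := by
  have hlogQ : Real.log Q ≤ Real.log x := by
    rcases Nat.eq_zero_or_pos Q with rfl | hQ0
    · simp only [Nat.cast_zero, Real.log_zero]; linarith
    · exact Real.log_le_log (by exact_mod_cast hQ0) hQ
  have h0 : 0 ≤ 1 + Real.log Q := by have := Real.log_natCast_nonneg Q; linarith
  calc totientInvSum Q ≤ (1 + Real.log Q) ^ 2 := totientInvSum_le Q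
    _ ≤ (2 * Real.log x) ^ 2 := pow_le_pow_left₀ h0 (by linarith) 2
    _ = 4 * Real.log x ^ 2 := by ring

/-- The final comparison: with `Y = x/L^A`, `L ≥ 1`, `x ≥ 1`,
`S ≤ C₀ Y`, `W ≤ 4L²`, `Q ≤ x^θ`, `x^θ L² ≤ Y`, `x^{1−η} L³ ≤ Y` imply
`S + (x/L^{A+2}) W + 3 Q L² + (xL + x) K x^{−η} L² + Q L ≤ (C₀ + 8 + 2 max(K, 0)) Y`. [folklore] -/
theorem numeric_bound {x L A θ η C₀ K S W : ℝ} {Q : ℕ} (hx : 1 ≤ x) (hL : 1 ≤ L)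
    (hS : S ≤ C₀ * (x / L ^ A)) (hW : W ≤ 4 * L ^ 2) (hQ : (Q : ℝ) ≤ x ^ θ)
    (h₁ : x ^ θ * L ^ 2 ≤ x / L ^ A) (h₂ : x ^ (1 - η) * L ^ 3 ≤ x / L ^ A) :
    S + x / L ^ (A + 2) * W + Q * (3 * L ^ 2) + (x * L + x) * (K * x ^ (-η) * L ^ 2) + Q * L ≤
      (C₀ + 8 + 2 * max K 0) * (x / L ^ A) := by
  have hx0 : 0 < x := by linarith
  have hL0 : 0 < L := by linarith
  have hLA : 0 < L ^ A := Real.rpow_pos_of_pos hL0 A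
  set Y := x / L ^ A with hY
  have hY0 : 0 ≤ Y := by positivity
  have hxθ : 0 ≤ x ^ θ := Real.rpow_nonneg hx0.le θ
  have t2 : x / L ^ (A + 2) * W ≤ 4 * Y := by
    have hLA2 : L ^ (A + 2) = L ^ A * L ^ 2 := by rw [Real.rpow_add hL0, Real.rpow_two]
    have h0 : 0 ≤ x / L ^ (A + 2) := by positivity
    calc x / L ^ (A + 2) * W ≤ x / L ^ (A + 2) * (4 * L ^ 2) := mul_le_mul_of_nonneg_left hW h0
      _ = 4 * Y := by rw [hLA2, hY]; field_simp
  have t3 : (Q : ℝ) * (3 * L ^ 2) ≤ 3 * Y := by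
    calc (Q : ℝ) * (3 * L ^ 2) ≤ x ^ θ * (3 * L ^ 2) := by gcongr
      _ = 3 * (x ^ θ * L ^ 2) := by ring
      _ ≤ 3 * Y := by gcongr
  have hxη : x * x ^ (-η) = x ^ (1 - η) := by
    rw [sub_eq_add_neg, Real.rpow_add hx0, Real.rpow_one]
  have t4 : (x * L + x) * (K * x ^ (-η) * L ^ 2) ≤ 2 * max K 0 * Y := by
    have hK : K ≤ max K 0 := le_max_left _ _
    have hxe : 0 ≤ x ^ (-η) := Real.rpow_nonneg hx0.le _
    have hxL : 0 ≤ x * L + x := by positivity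
    have hxL2 : x * L + x ≤ 2 * (x * L) := by nlinarith
    calc (x * L + x) * (K * x ^ (-η) * L ^ 2)
        ≤ (x * L + x) * (max K 0 * x ^ (-η) * L ^ 2) := by gcongr
      _ ≤ (2 * (x * L)) * (max K 0 * x ^ (-η) * L ^ 2) := by gcongr
      _ = 2 * max K 0 * ((x * x ^ (-η)) * L ^ 3) := by ring
      _ = 2 * max K 0 * (x ^ (1 - η) * L ^ 3) := by rw [hxη]
      _ ≤ 2 * max K 0 * Y := by gcongr
  have t5 : (Q : ℝ) * L ≤ Y := by
    have hLL : L ≤ L ^ 2 := by nlinarith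
    calc (Q : ℝ) * L ≤ x ^ θ * L := by gcongr
      _ ≤ x ^ θ * L ^ 2 := by gcongr
      _ ≤ Y := h₁
  linarith

/-! ### The stub -/

/-- **Descent** (stub 5 of the line, the transfer): the four inputs `H1`–`H4` of the line
`upward-replication-free-factorability`, taken verbatim as hypotheses, imply the Wave0 form
`Literature.NumberTheory.Sieve.ElliottHalberstamConjecture = ∀ θ < 1, EH θ` of the
Elliott–Halberstam conjecture: triangle inequality `|Δ| ≤ E♭ + E♯`, good/bad split of the moduli
`q ≤ x^θ`, replication + purity on the good moduli, the trivial bound + harmonic sparsity on the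
bad ones, and the eventual comparisons of `x^θ L²`, `x^{1−η} L³` with `x/L^A`.
[cite: DavenportMNT1980, ch. 28] -/
theorem stub_descent :
    (∀ δ₀ : ℝ, 0 < δ₀ → δ₀ < 1 / 2 → ∀ θ : ℝ, θ < 1 → ∀ A : ℝ, 0 < A →
      (fun x : ℝ => ∑ q ∈ Finset.Icc 1 ⌊x ^ θ⌋₊, ⨆ a : (ZMod q)ˣ,
          ‖((Literature.NumberTheory.Sieve.ParityWave0.chebyshevPsiMod q (a : ZMod q) x -
                  x / (Nat.totient q : ℝ) : ℝ) : ℂ) -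
              ((Nat.totient q : ℂ))⁻¹ *
                ∑ χ ∈ (Finset.univ : Finset (DirichletCharacter ℂ q)) with
                    ⌊x ^ (1 / 2 - δ₀)⌋₊ < χ.conductor,
                  χ (a : ZMod q)⁻¹ * Literature.NumberTheory.Sieve.chebyshevPsiChar χ x‖) =O[Filter.atTop]
        fun x : ℝ => x / Real.log x ^ A) →
    (∀ (D : ℕ) (x : ℝ), 1 ≤ x → ∀ q : ℕ, 1 ≤ q → ∀ p : ℕ, p.Prime → ¬ p ∣ q →
      (⨆ a : (ZMod q)ˣ,
          ‖((Nat.totient q : ℂ))⁻¹ *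
              ∑ χ ∈ (Finset.univ : Finset (DirichletCharacter ℂ q)) with D < χ.conductor,
                χ (a : ZMod q)⁻¹ * Literature.NumberTheory.Sieve.chebyshevPsiChar χ x‖) ≤
        ((p : ℝ) - 1) *
            (⨆ a : (ZMod (q * p))ˣ,
              ‖((Nat.totient (q * p) : ℂ))⁻¹ *
                  ∑ χ ∈ (Finset.univ : Finset (DirichletCharacter ℂ (q * p))) with D < χ.conductor,
                    χ (a : ZMod (q * p))⁻¹ * Literature.NumberTheory.Sieve.chebyshevPsiChar χ x‖) +
          Literature.NumberTheory.Sieve.nonCoprimePart (q * p) x) →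
    (∀ ε' : ℝ, 0 < ε' → ε' ≤ 1 / 2 → ∀ B : ℝ, 0 < B →
      ∃ δ₀ : ℝ, 0 < δ₀ ∧ δ₀ < 1 / 2 ∧ ∃ η : ℝ, 0 < η ∧ ∃ x₀ : ℝ, ∀ x : ℝ, x₀ ≤ x →
        ∃ I : Finset ℕ, (I.card : ℝ) ≤ x ^ (1 - ε' - η) ∧
          ∀ m ∈ Finset.Ioc ⌊x ^ (1 - ε')⌋₊ ⌊2 * x ^ (1 - ε')⌋₊, m ∉ I →
            (⨆ a : (ZMod m)ˣ,
                ‖((Nat.totient m : ℂ))⁻¹ *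
                    ∑ χ ∈ (Finset.univ : Finset (DirichletCharacter ℂ m)) with
                        ⌊x ^ (1 / 2 - δ₀)⌋₊ < χ.conductor,
                      χ (a : ZMod m)⁻¹ * Literature.NumberTheory.Sieve.chebyshevPsiChar χ x‖) <
              x / ((Nat.totient m : ℝ) * Real.log x ^ B)) →
    (∀ ε' η θ : ℝ, 0 < ε' → 0 < η → 0 < 1 - ε' - θ →
      ∃ K x₁ : ℝ, ∀ x : ℝ, x₁ ≤ x → ∀ I : Finset ℕ, (I.card : ℝ) ≤ x ^ (1 - ε' - η) →
        ∀ Bad : Finset ℕ, Bad ⊆ Finset.Icc 1 ⌊x ^ θ⌋₊ →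
          (∀ q ∈ Bad, ∀ p : ℕ, p.Prime → ¬ p ∣ q →
              x ^ (1 - ε') / q < p → (p : ℝ) ≤ 2 * x ^ (1 - ε') / q → q * p ∈ I) →
            ∑ q ∈ Bad, ((Nat.totient q : ℝ))⁻¹ ≤ K * x ^ (-η) * Real.log x ^ 2) →
    Literature.NumberTheory.Sieve.ElliottHalberstamConjecture := by
  intro h1 h2 h3 h4 θ hθ
  -- the claim for `A > 0`
  have key : ∀ A : ℝ, 0 < A →
      (fun x : ℝ => ∑ q ∈ Icc 1 ⌊x ^ θ⌋₊,
        ⨆ a : (ZMod q)ˣ, |ParityWave0.chebyshevPsiMod q a x - x / Nat.totient q|) =O[atTop]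
      fun x : ℝ => x / Real.log x ^ A := by
    intro A hA
    have hε : 0 < min (1 / 2 : ℝ) ((1 - θ) / 2) := lt_min (by norm_num) (by linarith)
    have hε2 : min (1 / 2 : ℝ) ((1 - θ) / 2) ≤ 1 / 2 := min_le_left _ _
    have hκ : 0 < 1 - min (1 / 2 : ℝ) ((1 - θ) / 2) - θ := by
      have := min_le_right (1 / 2 : ℝ) ((1 - θ) / 2); linarith
    set ε' := min (1 / 2 : ℝ) ((1 - θ) / 2) with hε'
    obtain ⟨δ₀, hδ₀, hδ₀', η, hη, x₀, hpur⟩ := h3 ε' hε hε2 (A + 2) (by linarith)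
    obtain ⟨K, x₁, hbad⟩ := h4 ε' η θ hε hη hκ
    obtain ⟨C₀, hC₀⟩ := (h1 δ₀ hδ₀ hδ₀' θ hθ A hA).bound
    refine IsBigO.of_bound (C₀ + 8 + 2 * max K 0) ?_
    filter_upwards [hC₀, eventually_ge_atTop x₀, eventually_ge_atTop x₁,
      eventually_ge_atTop (2 : ℝ), Real.tendsto_log_atTop.eventually_ge_atTop (1 : ℝ),
      eventually_rpow_mul_log_pow_le 2 A (sub_pos.2 hθ),
      eventually_rpow_mul_log_pow_le 3 A hη] with x hC₀x hx₀ hx₁ hx2 hL1 hev1 hev2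
    have hx1 : (1 : ℝ) ≤ x := by linarith
    have hx0 : (0 : ℝ) ≤ x := by linarith
    have hL0 : 0 ≤ Real.log x := by linarith
    have hw : x ^ (1 - ε') ≤ x := by
      calc x ^ (1 - ε') ≤ x ^ (1 : ℝ) := Real.rpow_le_rpow_of_exponent_le hx1 (by linarith)
        _ = x := Real.rpow_one x
    have hxθ : x ^ θ ≤ x := by
      calc x ^ θ ≤ x ^ (1 : ℝ) := Real.rpow_le_rpow_of_exponent_le hx1 hθ.le
        _ = x := Real.rpow_one x
    obtain ⟨I, hI, hpurx⟩ := hpur x hx₀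
    have main := sum_le_of_good_bad (Q := ⌊x ^ θ⌋₊) (I := I) (w := x ^ (1 - ε'))
      (M := Real.log x ^ (A + 2)) (K' := K * x ^ (-η) * Real.log x ^ 2)
      (r := 3 * Real.log x ^ 2) (L := Real.log x) (x := x)
      (T := fun q => ⨆ a : (ZMod q)ˣ, |ParityWave0.chebyshevPsiMod q a x - x / Nat.totient q|)
      (Eb := fun q => ⨆ a : (ZMod q)ˣ,
        ‖((ParityWave0.chebyshevPsiMod q (a : ZMod q) x - x / (Nat.totient q : ℝ) : ℝ) : ℂ) -
          ((Nat.totient q : ℂ))⁻¹ *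
            ∑ χ ∈ (Finset.univ : Finset (DirichletCharacter ℂ q)) with
              ⌊x ^ (1 / 2 - δ₀)⌋₊ < χ.conductor, χ (a : ZMod q)⁻¹ * chebyshevPsiChar χ x‖)
      (Es := fun m => ⨆ a : (ZMod m)ˣ,
        ‖((Nat.totient m : ℂ))⁻¹ *
          ∑ χ ∈ (Finset.univ : Finset (DirichletCharacter ℂ m)) with
            ⌊x ^ (1 / 2 - δ₀)⌋₊ < χ.conductor, χ (a : ZMod m)⁻¹ * chebyshevPsiChar χ x‖)
      (R := fun m => nonCoprimePart m x)
      hx0 hL0 (Real.rpow_pos_of_pos (by linarith) _) (by positivity)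
      (fun q hq => by
        haveI : NeZero q := ⟨by have := (Finset.mem_Icc.1 hq).1; omega⟩
        exact ciSup_abs_le_ciSup_add _ _)
      (fun q hq => ciSup_abs_sub_le_trivial (Finset.mem_Icc.1 hq).1 hx1)
      (fun q _ => Real.iSup_nonneg fun a => norm_nonneg _)
      (fun q hq p hp hpq => h2 _ x hx1 q (Finset.mem_Icc.1 hq).1 p hp hpq)
      (fun m hm hmw => nonCoprimePart_le_three_mul_log_sq hm hx2 (hmw.trans (by linarith)))
      hpurx (fun Bad hB hBI => hbad x hx₁ I hI Bad hB hBI)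
    rw [Real.norm_of_nonneg (Finset.sum_nonneg fun q _ => Real.iSup_nonneg fun a => abs_nonneg _),
      Real.norm_of_nonneg (div_nonneg hx0 (Real.rpow_nonneg hL0 _))]
    refine main.trans ?_
    have hS := hC₀x
    rw [Real.norm_of_nonneg (Finset.sum_nonneg fun q _ => Real.iSup_nonneg fun a => norm_nonneg _),
      Real.norm_of_nonneg (div_nonneg hx0 (Real.rpow_nonneg hL0 _))] at hS
    have hQ : (⌊x ^ θ⌋₊ : ℝ) ≤ x ^ θ := Nat.floor_le (Real.rpow_nonneg hx0 _)
    have hev1' : x ^ θ * Real.log x ^ 2 ≤ x / Real.log x ^ A := by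
      have h := hev1; rwa [show (1 : ℝ) - (1 - θ) = θ by ring] at h
    exact numeric_bound hx1 hL1 hS (totientInvSum_le_four_mul_log_sq (hQ.trans hxθ) hL1) hQ
      hev1' hev2
  -- all real `A`
  intro A
  refine (key (max A 1) (lt_max_of_lt_right one_pos)).trans (IsBigO.of_bound 1 ?_)
  filter_upwards [Real.tendsto_log_atTop.eventually_ge_atTop (1 : ℝ),
    eventually_ge_atTop (0 : ℝ)] with x hL hx
  have hL0 : 0 < Real.log x := by linarith
  rw [one_mul, Real.norm_of_nonneg (div_nonneg hx (Real.rpow_nonneg hL0.le _)),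
    Real.norm_of_nonneg (div_nonneg hx (Real.rpow_nonneg hL0.le _))]
  exact div_le_div_of_nonneg_left hx (Real.rpow_pos_of_pos hL0 _)
    (Real.rpow_le_rpow_of_exponent_le hL (le_max_left _ _))

end Summit.Parity.GeneralizedHardyLittlewood.Theorems.EH.Descent
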